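import Summits.BirchSwinnertonDyer.BirchSwinnertonDyer.Theorems.ClassRecordThreeEulerHalvesAtThreeHybridInertSavingManyCarriersServable
import HarnessLib

/-!
# Route `ClassRecordThree` (rung K2@3), crux 5 `EulerHalvesAtThree` (item stmt-BirchSwinnertonDyer-19109, shared by
# `KolyvaginRoadThree`): servability of the carrier-inert Shimura road with ONE exempted carrier and an ODD number of
# split-multiplicative carriers — the IMC-grade residual «one non-split carrier and three split ones» CUT FURTHER
# (cell `bsd-stepL`, seat `bsd-stepL-tam3-p1` g13, owner of the line; `--supports stmt-BirchSwinnertonDyer-19109 --as helper`)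

HONEST FRAMING: THEOREMS ONLY (no definition, no named fact, no `sorry`); pure finite bookkeeping on the reduction types
and Tamagawa numbers of ONE curve — nothing about `Ш`, no display, no BSD class theorem; no census label moves (T7); item
19109 is NOT closed. BSD is not proved by any of this.

WHAT. g12's `…HybridInertSavingManyCarriersServable` (`residualShape_of_ram_of_not_servable`) left to the IMC-grade input
CoS₃ every X11b@3 curve with a (ram) witness `ℓ₀`, ONE non-split carrier prime `g ≠ 3` (type IV ∕ IV*, `c = 3`, the
exempted place of Jetchev's saving) and an ODD number `#B ≥ 3` of split-multiplicative carrier primes `b ≠ 3` — because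
the even inert set used there, `S = {3, ℓ₀} ∪ B`, has odd cardinality. This file serves most of that population with the
inert set `S = {3} ∪ B` (EVEN exactly when `#B` is odd), whose (DEG) datum is no longer the witness `ℓ₀ ∈ S` but one of:
* `inertSavingServable_of_allSplitBut_of_odd_of_pairingHalf` — a Papikian–Rabinoff half `R = {3} ∪ R′`, `R′ ⊆ B`,
  `#B = 2·#R′ + 1`, every `b ∈ R′` odd with `b ≢ 1 (mod 3)` (Pasten Lemma 6.18; `3` itself always qualifies: `3 ≠ 2`,
  `3 ∤ 2`);
* `inertSavingServable_of_allSplitBut_of_odd_of_three` — the witness `3 ∈ S` itself when `3 ∤ ord₃ Δ_min`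
  (Pasten Lemma 6.15 at the inert prime `3`);
* `inertSavingServable_of_allSplitBut_of_odd_of_spare` — TWO multiplicative primes outside `{3} ∪ B` (the (ram)
  witness `ℓ₀` and a spare `t`): `S = {3, ℓ₀, t} ∪ B` is even again and carries the witness inside (Pasten Lemma 6.15);
and records the sharper residual:
* `residualShapeOdd_of_ram_of_not_servable` — an X11b@3 curve with a (ram) witness that is neither inert- nor
  saving-servable has a NON-split carrier prime `q₀ ≠ 3` AND EITHER a second non-split carrier prime `≠ 3`, OR: the set
  `B` of split carriers `≠ 3` has odd cardinality `≥ 3`, `3 ∣ ord₃ Δ_min`, there is AT MOST ONE multiplicative prime outside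
  `{3} ∪ B`, and NO `R′ ⊆ B` with `#B = 2·#R′ + 1` consists of odd primes `≢ 1 (mod 3)`.
So after this file the IMC-grade binder of 19109's line is asked only under «¬(ram) ∨ two non-split (type IV∕IV*) carrier
primes ≠ 3 ∨ (a non-split carrier prime ≠ 3 ∧ `#B` odd ≥ 3 ∧ `3 ∣ ord₃Δ_min` ∧ ≤ 1 multiplicative prime outside `{3} ∪ B`
∧ no Papikian–Rabinoff half inside `{3} ∪ B`)» — a STRICTLY STRONGER hypothesis on the binder than g12's. Census pointer
(EVIDENCE, T7): 0 of the 568 TRUE-OPEN (T2′)@3 frames of the window either way (every r2-residual frame has exactly one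
carrier prime `≠ 3`); the cut is CLASS-WIDE. The bundle shape served is VERBATIM the hypothesis `hsserv` of g11's
`missingUpperBoundAt_three_of_classX11b_of_inertSavingServable` (exempted prime `q₁`, SHAPE off `q₁`, even multiplicative
`S ∋ 3` missing `q₁` and containing every other split carrier, (DEG) datum).

References: [PastenShimura2024] Lemmas 6.15, 6.18 (arXiv v4 p. 31); [PapikianRabinoff2016] Cor. 3.5; [RibetTakahashi1997]
Thms. 1–2; [SilvermanATAEC1994] Cor. IV.9.2(d), IV.9.4; [Jetchev2008] Thm. 1.1, Cor. 1.5; [Kim2022HigherGZ] Rem. 7.9.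
presearch: not applicable (finite bookkeeping over tree predicates); `lean search 'allSplitBut_of_odd|residualShapeOdd'` → none.
-/

noncomputable section

open scoped Classical NumberField

namespace Summit.BirchSwinnertonDyer.Rank1Residual.X11b.Three.Koly

open WeierstrassCurve NumberField IsDedekindDomain Field Literature.NumberTheory.EllipticCurves
  Literature.NumberTheory.EllipticCurves.Rank1Residual Literature.NumberTheory.EllipticCurves.Rank1Residual.Typed
  Summit.BirchSwinnertonDyer.Rank1Residual Summit.BirchSwinnertonDyer.Rank1Residual.X11b
  Summit.BirchSwinnertonDyer.BirchSwinnertonDyer.Theorems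

/-! ### §1 Saving-servability with one exempted carrier and an ODD number of other split carriers -/

/-- **SAVING-servability, `#(B ∖ {q₁})` odd, (DEG) by a Papikian–Rabinoff half.** On an X11b@3 curve with a (ram) witness
and a carrier prime `q₁ ≠ 3` (`3 ∣ c_{q₁}(E)`, split or not), if every OTHER prime `q ≠ q₁` with `3 ∣ c_q(E)` is split
multiplicative, `B′ := B ∖ {q₁}` (the other split carriers `≠ 3`) has `#B′ = 2·#R′ + 1` for some `R′ ⊆ B′` all of whose
members are odd primes `≢ 1 (mod 3)`, then g11's saving-servable bundle holds with the exempted prime `q₁`, the inert set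
`S = {3} ∪ B′` (even) and the pairing half `R = {3} ∪ R′` (`#S = 2·#R`; `3 ≠ 2`, `3 ∤ 3 − 1`).
[cite: PastenShimura2024, Lemma 6.18 (arXiv v4 p. 31)] [cite: PapikianRabinoff2016, Cor. 3.5] [cite: Jetchev2008, Thm. 1.1] -/
theorem inertSavingServable_of_allSplitBut_of_odd_of_pairingHalf
    (W : WeierstrassCurve ℚ) [W.IsElliptic] [W.IsGloballyMinimal] (hX : ClassX11b W 3) (hram : Ram W 3)
    (q₁ : ℕ) [hq₁ : Fact q₁.Prime] (hq₁3 : q₁ ≠ 3) (hc₁ : 3 ∣ (W.baseChange ℚ_[q₁]).localTamagawaNumber ℤ_[q₁])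
    (hall : ∀ (q : ℕ) [Fact q.Prime], q ≠ 3 → q ≠ q₁ → 3 ∣ (W.baseChange ℚ_[q]).localTamagawaNumber ℤ_[q] →
      W.HasSplitMultiplicativeReductionAtPrime q)
    (B : Finset ℕ)
    (hB : ∀ q : ℕ, q ∈ B ↔ ∃ _ : Fact q.Prime, q ≠ 3 ∧ W.HasSplitMultiplicativeReductionAtPrime q ∧
      3 ∣ padicValInt q W.minimalDiscriminantInt)
    (R' : Finset ℕ) (hR'B : R' ⊆ B.erase q₁) (hcardR' : (B.erase q₁).card = 2 * R'.card + 1)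
    (hR' : ∀ b ∈ R', b ≠ 2 ∧ ¬ 3 ∣ b - 1) :
    Ram W 3 ∧ ∃ (q₁ : ℕ) (_ : Fact q₁.Prime), ¬ W.HasGoodReductionAtPrime q₁ ∧
      (∀ (q : ℕ) [Fact q.Prime], q ≠ q₁ → 3 ∣ (W.baseChange ℚ_[q]).localTamagawaNumber ℤ_[q] →
        W.HasSplitMultiplicativeReductionAtPrime q) ∧
      ∃ S : Finset ℕ, (∀ ℓ ∈ S, ∃ _ : Fact ℓ.Prime, Mult W ℓ) ∧ Even S.card ∧ 3 ∈ S ∧ q₁ ∉ S ∧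
        (∀ (ℓ : ℕ) [Fact ℓ.Prime], ℓ ∉ S → ℓ ≠ q₁ → W.HasSplitMultiplicativeReductionAtPrime ℓ →
          ¬ 3 ∣ padicValInt ℓ W.minimalDiscriminantInt) ∧
        ((∃ (ℓ₁ : ℕ) (_ : Fact ℓ₁.Prime), Mult W ℓ₁ ∧ ¬ 3 ∣ padicValInt ℓ₁ W.minimalDiscriminantInt ∧
            (ℓ₁ ∈ S ∨ ∃ (t : ℕ) (_ : Fact t.Prime), Mult W t ∧ t ∉ S ∧ t ≠ ℓ₁)) ∨
          ∃ R ⊆ S, S.card = 2 * R.card ∧ ∀ q ∈ R, q ≠ 2 ∧ ¬ 3 ∣ q - 1) := by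
  obtain ⟨-, -, hmult3, -⟩ := id hX
  set B' : Finset ℕ := B.erase q₁ with hB'def
  have h3B' : 3 ∉ B' := fun h ↦ by
    obtain ⟨_, h3, -⟩ := (hB 3).mp (Finset.mem_of_mem_erase h); exact h3 rfl
  have h3R' : 3 ∉ R' := fun h ↦ h3B' (hR'B h)
  refine ⟨hram, q₁, hq₁, ?_, ?_, insert 3 B', ?_, ?_, by simp, ?_, ?_,
    Or.inr ⟨insert 3 R', Finset.insert_subset_insert _ hR'B, ?_, ?_⟩⟩
  · -- `q₁` is bad: at a good prime `c = 1`
    intro hgood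
    haveI : (W.baseChange ℚ_[q₁]).IsElliptic := inferInstanceAs (W.map (algebraMap ℚ ℚ_[q₁])).IsElliptic
    have hc1 : (W.baseChange ℚ_[q₁]).localTamagawaNumber ℤ_[q₁] = 1 := by
      haveI : ((W.baseChange ℚ_[q₁]).minimal ℤ_[q₁]).HasGoodReduction ℤ_[q₁] := hgood
      exact localTamagawaNumber_eq_one_of_hasGoodReduction_holds ℤ_[q₁] _
    rw [hc1] at hc₁
    exact absurd (Nat.le_of_dvd one_pos hc₁) (by decide)
  · -- the SHAPE off `q₁`
    intro q _ hq h3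
    by_cases hq3 : q = 3
    · subst hq3
      exact (split_and_three_dvd_of_mult_of_three_dvd_localTamagawaNumber W 3 hmult3 h3).1
    · exact hall q hq3 hq h3
  · intro ℓ hℓ
    rcases Finset.mem_insert.mp hℓ with rfl | hℓ
    · exact ⟨⟨Nat.prime_three⟩, hmult3⟩
    · obtain ⟨hF, -, hs, -⟩ := (hB ℓ).mp (Finset.mem_of_mem_erase hℓ)
      exact ⟨hF, hs.hasMultiplicativeReductionAtPrime⟩
  · rw [Finset.card_insert_of_notMem h3B']
    exact ⟨R'.card + 1, by omega⟩
  · simp only [Finset.mem_insert, not_or, hB'def, Finset.mem_erase, ne_eq, not_true_eq_false, false_and,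
      not_false_eq_true, and_true]
    exact hq₁3
  · intro ℓ _ hℓS hℓq₁ hs hv
    have hℓ3 : ℓ ≠ 3 := fun h ↦ hℓS (by simp [h])
    exact hℓS (Finset.mem_insert_of_mem (Finset.mem_erase.mpr ⟨hℓq₁, (hB ℓ).mpr ⟨‹_›, hℓ3, hs, hv⟩⟩))
  · rw [Finset.card_insert_of_notMem h3B', Finset.card_insert_of_notMem h3R']
    omega
  · intro q hq
    rcases Finset.mem_insert.mp hq with rfl | hq
    · decide
    · exact hR' q hq

/-- **SAVING-servability, `#(B ∖ {q₁})` odd, (DEG) by the witness `3` itself.** As the previous theorem, with `#B′` odd and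
`3 ∤ ord₃ Δ_min` (the curve is multiplicative at `3` on X11b@3, so `3` is then a (ram)-type witness INSIDE `S = {3} ∪ B′`).
[cite: PastenShimura2024, Lemma 6.15 (arXiv v4 p. 31)] [cite: Jetchev2008, Thm. 1.1] -/
theorem inertSavingServable_of_allSplitBut_of_odd_of_three
    (W : WeierstrassCurve ℚ) [W.IsElliptic] [W.IsGloballyMinimal] (hX : ClassX11b W 3) (hram : Ram W 3)
    (q₁ : ℕ) [hq₁ : Fact q₁.Prime] (hq₁3 : q₁ ≠ 3) (hc₁ : 3 ∣ (W.baseChange ℚ_[q₁]).localTamagawaNumber ℤ_[q₁])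
    (hall : ∀ (q : ℕ) [Fact q.Prime], q ≠ 3 → q ≠ q₁ → 3 ∣ (W.baseChange ℚ_[q]).localTamagawaNumber ℤ_[q] →
      W.HasSplitMultiplicativeReductionAtPrime q)
    (B : Finset ℕ)
    (hB : ∀ q : ℕ, q ∈ B ↔ ∃ _ : Fact q.Prime, q ≠ 3 ∧ W.HasSplitMultiplicativeReductionAtPrime q ∧
      3 ∣ padicValInt q W.minimalDiscriminantInt)
    (hodd : Odd (B.erase q₁).card) (h3v : ¬ 3 ∣ padicValInt 3 W.minimalDiscriminantInt) :
    Ram W 3 ∧ ∃ (q₁ : ℕ) (_ : Fact q₁.Prime), ¬ W.HasGoodReductionAtPrime q₁ ∧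
      (∀ (q : ℕ) [Fact q.Prime], q ≠ q₁ → 3 ∣ (W.baseChange ℚ_[q]).localTamagawaNumber ℤ_[q] →
        W.HasSplitMultiplicativeReductionAtPrime q) ∧
      ∃ S : Finset ℕ, (∀ ℓ ∈ S, ∃ _ : Fact ℓ.Prime, Mult W ℓ) ∧ Even S.card ∧ 3 ∈ S ∧ q₁ ∉ S ∧
        (∀ (ℓ : ℕ) [Fact ℓ.Prime], ℓ ∉ S → ℓ ≠ q₁ → W.HasSplitMultiplicativeReductionAtPrime ℓ →
          ¬ 3 ∣ padicValInt ℓ W.minimalDiscriminantInt) ∧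
        ((∃ (ℓ₁ : ℕ) (_ : Fact ℓ₁.Prime), Mult W ℓ₁ ∧ ¬ 3 ∣ padicValInt ℓ₁ W.minimalDiscriminantInt ∧
            (ℓ₁ ∈ S ∨ ∃ (t : ℕ) (_ : Fact t.Prime), Mult W t ∧ t ∉ S ∧ t ≠ ℓ₁)) ∨
          ∃ R ⊆ S, S.card = 2 * R.card ∧ ∀ q ∈ R, q ≠ 2 ∧ ¬ 3 ∣ q - 1) := by
  obtain ⟨-, -, hmult3, -⟩ := id hX
  set B' : Finset ℕ := B.erase q₁ with hB'def
  have h3B' : 3 ∉ B' := fun h ↦ by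
    obtain ⟨_, h3, -⟩ := (hB 3).mp (Finset.mem_of_mem_erase h); exact h3 rfl
  refine ⟨hram, q₁, hq₁, ?_, ?_, insert 3 B', ?_, ?_, by simp, ?_, ?_,
    Or.inl ⟨3, ⟨Nat.prime_three⟩, hmult3, h3v, Or.inl (by simp)⟩⟩
  · -- `q₁` is bad: at a good prime `c = 1`
    intro hgood
    haveI : (W.baseChange ℚ_[q₁]).IsElliptic := inferInstanceAs (W.map (algebraMap ℚ ℚ_[q₁])).IsElliptic
    have hc1 : (W.baseChange ℚ_[q₁]).localTamagawaNumber ℤ_[q₁] = 1 := by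
      haveI : ((W.baseChange ℚ_[q₁]).minimal ℤ_[q₁]).HasGoodReduction ℤ_[q₁] := hgood
      exact localTamagawaNumber_eq_one_of_hasGoodReduction_holds ℤ_[q₁] _
    rw [hc1] at hc₁
    exact absurd (Nat.le_of_dvd one_pos hc₁) (by decide)
  · -- the SHAPE off `q₁`
    intro q _ hq h3
    by_cases hq3 : q = 3
    · subst hq3
      exact (split_and_three_dvd_of_mult_of_three_dvd_localTamagawaNumber W 3 hmult3 h3).1
    · exact hall q hq3 hq h3
  · intro ℓ hℓ
    rcases Finset.mem_insert.mp hℓ with rfl | hℓ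
    · exact ⟨⟨Nat.prime_three⟩, hmult3⟩
    · obtain ⟨hF, -, hs, -⟩ := (hB ℓ).mp (Finset.mem_of_mem_erase hℓ)
      exact ⟨hF, hs.hasMultiplicativeReductionAtPrime⟩
  · rw [Finset.card_insert_of_notMem h3B']
    obtain ⟨r, hr⟩ := hodd
    exact ⟨r + 1, by omega⟩
  · simp only [Finset.mem_insert, not_or, hB'def, Finset.mem_erase, ne_eq, not_true_eq_false, false_and,
      not_false_eq_true, and_true]
    exact hq₁3
  · intro ℓ _ hℓS hℓq₁ hs hv
    have hℓ3 : ℓ ≠ 3 := fun h ↦ hℓS (by simp [h])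
    exact hℓS (Finset.mem_insert_of_mem (Finset.mem_erase.mpr ⟨hℓq₁, (hB ℓ).mpr ⟨‹_›, hℓ3, hs, hv⟩⟩))

/-- **SAVING-servability, `#(B ∖ {q₁})` odd, (DEG) by the (ram) witness and ONE SPARE multiplicative prime.** As above, with
`#B′` odd, a (ram) witness `ℓ₀` (multiplicative, `ℓ₀ ≠ 3`, `3 ∤ ord_{ℓ₀} Δ_min`) and a second multiplicative prime
`t ∉ B`, `t ≠ 3`, `t ≠ ℓ₀`: the inert set `S = {3, ℓ₀, t} ∪ B′` is even and carries the witness inside.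
[cite: PastenShimura2024, Lemma 6.15 (arXiv v4 p. 31)] [cite: Jetchev2008, Thm. 1.1] -/
theorem inertSavingServable_of_allSplitBut_of_odd_of_spare
    (W : WeierstrassCurve ℚ) [W.IsElliptic] [W.IsGloballyMinimal] (hX : ClassX11b W 3)
    (q₁ : ℕ) [hq₁ : Fact q₁.Prime] (hq₁3 : q₁ ≠ 3) (hc₁ : 3 ∣ (W.baseChange ℚ_[q₁]).localTamagawaNumber ℤ_[q₁])
    (hall : ∀ (q : ℕ) [Fact q.Prime], q ≠ 3 → q ≠ q₁ → 3 ∣ (W.baseChange ℚ_[q]).localTamagawaNumber ℤ_[q] →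
      W.HasSplitMultiplicativeReductionAtPrime q)
    (B : Finset ℕ)
    (hB : ∀ q : ℕ, q ∈ B ↔ ∃ _ : Fact q.Prime, q ≠ 3 ∧ W.HasSplitMultiplicativeReductionAtPrime q ∧
      3 ∣ padicValInt q W.minimalDiscriminantInt)
    (hodd : Odd (B.erase q₁).card)
    {ℓ₀ : ℕ} [hℓ₀F : Fact ℓ₀.Prime] (hℓ₀3 : ℓ₀ ≠ 3) (hmult₀ : Mult W ℓ₀)
    (hram₀ : ¬ 3 ∣ padicValInt ℓ₀ W.minimalDiscriminantInt)
    {t : ℕ} [htF : Fact t.Prime] (ht3 : t ≠ 3) (hmt : Mult W t) (htB : t ∉ B) (htℓ₀ : t ≠ ℓ₀) :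
    Ram W 3 ∧ ∃ (q₁ : ℕ) (_ : Fact q₁.Prime), ¬ W.HasGoodReductionAtPrime q₁ ∧
      (∀ (q : ℕ) [Fact q.Prime], q ≠ q₁ → 3 ∣ (W.baseChange ℚ_[q]).localTamagawaNumber ℤ_[q] →
        W.HasSplitMultiplicativeReductionAtPrime q) ∧
      ∃ S : Finset ℕ, (∀ ℓ ∈ S, ∃ _ : Fact ℓ.Prime, Mult W ℓ) ∧ Even S.card ∧ 3 ∈ S ∧ q₁ ∉ S ∧
        (∀ (ℓ : ℕ) [Fact ℓ.Prime], ℓ ∉ S → ℓ ≠ q₁ → W.HasSplitMultiplicativeReductionAtPrime ℓ →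
          ¬ 3 ∣ padicValInt ℓ W.minimalDiscriminantInt) ∧
        ((∃ (ℓ₁ : ℕ) (_ : Fact ℓ₁.Prime), Mult W ℓ₁ ∧ ¬ 3 ∣ padicValInt ℓ₁ W.minimalDiscriminantInt ∧
            (ℓ₁ ∈ S ∨ ∃ (t : ℕ) (_ : Fact t.Prime), Mult W t ∧ t ∉ S ∧ t ≠ ℓ₁)) ∨
          ∃ R ⊆ S, S.card = 2 * R.card ∧ ∀ q ∈ R, q ≠ 2 ∧ ¬ 3 ∣ q - 1) := by
  obtain ⟨-, -, hmult3, -⟩ := id hX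
  set B' : Finset ℕ := B.erase q₁ with hB'def
  have h3B' : 3 ∉ B' := fun h ↦ by
    obtain ⟨_, h3, -⟩ := (hB 3).mp (Finset.mem_of_mem_erase h); exact h3 rfl
  have hℓ₀B' : ℓ₀ ∉ B' := fun h ↦ by
    obtain ⟨_, -, -, hv⟩ := (hB ℓ₀).mp (Finset.mem_of_mem_erase h); exact hram₀ hv
  have htB' : t ∉ B' := fun h ↦ htB (Finset.mem_of_mem_erase h)
  have hq₁ℓ₀ : q₁ ≠ ℓ₀ := by
    rintro rfl
    exact hram₀ (split_and_three_dvd_of_mult_of_three_dvd_localTamagawaNumber W q₁ hmult₀ hc₁).2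
  have hq₁t : q₁ ≠ t := by
    rintro rfl
    obtain ⟨hs, hv⟩ := split_and_three_dvd_of_mult_of_three_dvd_localTamagawaNumber W q₁ hmt hc₁
    exact htB ((hB q₁).mpr ⟨hq₁, hq₁3, hs, hv⟩)
  have hℓ₀S'' : ℓ₀ ∉ insert t B' := by
    rw [Finset.mem_insert, not_or]; exact ⟨Ne.symm htℓ₀, hℓ₀B'⟩
  have h3S' : (3 : ℕ) ∉ insert ℓ₀ (insert t B') := by
    simp only [Finset.mem_insert, not_or]; exact ⟨Ne.symm hℓ₀3, Ne.symm ht3, h3B'⟩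
  refine ⟨⟨ℓ₀, hℓ₀F, hℓ₀3, hmult₀, hram₀⟩, q₁, hq₁, ?_, ?_, insert 3 (insert ℓ₀ (insert t B')), ?_, ?_, by simp,
    ?_, ?_, Or.inl ⟨ℓ₀, hℓ₀F, hmult₀, hram₀, Or.inl (by simp)⟩⟩
  · -- `q₁` is bad: at a good prime `c = 1`
    intro hgood
    haveI : (W.baseChange ℚ_[q₁]).IsElliptic := inferInstanceAs (W.map (algebraMap ℚ ℚ_[q₁])).IsElliptic
    have hc1 : (W.baseChange ℚ_[q₁]).localTamagawaNumber ℤ_[q₁] = 1 := by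
      haveI : ((W.baseChange ℚ_[q₁]).minimal ℤ_[q₁]).HasGoodReduction ℤ_[q₁] := hgood
      exact localTamagawaNumber_eq_one_of_hasGoodReduction_holds ℤ_[q₁] _
    rw [hc1] at hc₁
    exact absurd (Nat.le_of_dvd one_pos hc₁) (by decide)
  · -- the SHAPE off `q₁`
    intro q _ hq h3
    by_cases hq3 : q = 3
    · subst hq3
      exact (split_and_three_dvd_of_mult_of_three_dvd_localTamagawaNumber W 3 hmult3 h3).1
    · exact hall q hq3 hq h3
  · intro ℓ hℓ
    rcases Finset.mem_insert.mp hℓ with rfl | hℓ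
    · exact ⟨⟨Nat.prime_three⟩, hmult3⟩
    · rcases Finset.mem_insert.mp hℓ with rfl | hℓ
      · exact ⟨hℓ₀F, hmult₀⟩
      · rcases Finset.mem_insert.mp hℓ with rfl | hℓ
        · exact ⟨htF, hmt⟩
        · obtain ⟨hF, -, hs, -⟩ := (hB ℓ).mp (Finset.mem_of_mem_erase hℓ)
          exact ⟨hF, hs.hasMultiplicativeReductionAtPrime⟩
  · rw [Finset.card_insert_of_notMem h3S', Finset.card_insert_of_notMem hℓ₀S'', Finset.card_insert_of_notMem htB']
    obtain ⟨r, hr⟩ := hodd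
    exact ⟨r + 2, by omega⟩
  · simp only [Finset.mem_insert, not_or, hB'def, Finset.mem_erase, ne_eq, not_true_eq_false, false_and,
      not_false_eq_true, and_true]
    exact ⟨hq₁3, hq₁ℓ₀, hq₁t⟩
  · intro ℓ _ hℓS hℓq₁ hs hv
    have hℓ3 : ℓ ≠ 3 := fun h ↦ hℓS (by simp [h])
    exact hℓS (Finset.mem_insert_of_mem (Finset.mem_insert_of_mem (Finset.mem_insert_of_mem
      (Finset.mem_erase.mpr ⟨hℓq₁, (hB ℓ).mpr ⟨‹_›, hℓ3, hs, hv⟩⟩))))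

/-! ### §2 The sharper residual SHAPE -/

/-- **The residual SHAPE of 19109's line after the odd-parity cut.** An X11b@3 curve with a (ram) witness that is neither
inert-servable (g9's bundle) nor saving-servable (g11's bundle) has a carrier prime `q₀ ≠ 3` that is NOT split multiplicative
(a place of Kodaira type IV ∕ IV* with `c = 3`) AND EITHER a second such prime, OR ALL of: the set `B` of split-multiplicative
carrier primes `≠ 3` has odd cardinality `≥ 3`; `3 ∣ ord₃ Δ_min`; there is at most one multiplicative prime outside
`{3} ∪ B`; no `R′ ⊆ B` with `#B = 2·#R′ + 1` consists of odd primes `≢ 1 (mod 3)`. Proof: g12's case analysis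
(`residualShape_of_ram_of_not_servable`) with the three constructors of §1 run in the last case. [folklore] -/
theorem residualShapeOdd_of_ram_of_not_servable
    (W : WeierstrassCurve ℚ) [W.IsElliptic] [W.IsGloballyMinimal] (hX : ClassX11b W 3) (hram : Ram W 3)
    (hserv : ¬ (Ram W 3 ∧
      (∀ (q : ℕ) [Fact q.Prime], 3 ∣ (W.baseChange ℚ_[q]).localTamagawaNumber ℤ_[q] →
        W.HasSplitMultiplicativeReductionAtPrime q) ∧
      ∃ S : Finset ℕ, (∀ ℓ ∈ S, ∃ _ : Fact ℓ.Prime, Mult W ℓ) ∧ Even S.card ∧ 3 ∈ S ∧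
        (∀ (ℓ : ℕ) [Fact ℓ.Prime], ℓ ∉ S → W.HasSplitMultiplicativeReductionAtPrime ℓ →
          ¬ 3 ∣ padicValInt ℓ W.minimalDiscriminantInt) ∧
        ((∃ (ℓ₁ : ℕ) (_ : Fact ℓ₁.Prime), Mult W ℓ₁ ∧ ¬ 3 ∣ padicValInt ℓ₁ W.minimalDiscriminantInt ∧
            (ℓ₁ ∈ S ∨ ∃ (t : ℕ) (_ : Fact t.Prime), Mult W t ∧ t ∉ S ∧ t ≠ ℓ₁)) ∨
          ∃ R ⊆ S, S.card = 2 * R.card ∧ ∀ q ∈ R, q ≠ 2 ∧ ¬ 3 ∣ q - 1)))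
    (hsav : ¬ (Ram W 3 ∧ ∃ (q₁ : ℕ) (_ : Fact q₁.Prime), ¬ W.HasGoodReductionAtPrime q₁ ∧
      (∀ (q : ℕ) [Fact q.Prime], q ≠ q₁ → 3 ∣ (W.baseChange ℚ_[q]).localTamagawaNumber ℤ_[q] →
        W.HasSplitMultiplicativeReductionAtPrime q) ∧
      ∃ S : Finset ℕ, (∀ ℓ ∈ S, ∃ _ : Fact ℓ.Prime, Mult W ℓ) ∧ Even S.card ∧ 3 ∈ S ∧ q₁ ∉ S ∧
        (∀ (ℓ : ℕ) [Fact ℓ.Prime], ℓ ∉ S → ℓ ≠ q₁ → W.HasSplitMultiplicativeReductionAtPrime ℓ →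
          ¬ 3 ∣ padicValInt ℓ W.minimalDiscriminantInt) ∧
        ((∃ (ℓ₁ : ℕ) (_ : Fact ℓ₁.Prime), Mult W ℓ₁ ∧ ¬ 3 ∣ padicValInt ℓ₁ W.minimalDiscriminantInt ∧
            (ℓ₁ ∈ S ∨ ∃ (t : ℕ) (_ : Fact t.Prime), Mult W t ∧ t ∉ S ∧ t ≠ ℓ₁)) ∨
          ∃ R ⊆ S, S.card = 2 * R.card ∧ ∀ q ∈ R, q ≠ 2 ∧ ¬ 3 ∣ q - 1))) :
    ∃ (q₀ : ℕ) (_ : Fact q₀.Prime), q₀ ≠ 3 ∧ 3 ∣ (W.baseChange ℚ_[q₀]).localTamagawaNumber ℤ_[q₀] ∧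
      ¬ W.HasSplitMultiplicativeReductionAtPrime q₀ ∧
      ((∃ (q₀' : ℕ) (_ : Fact q₀'.Prime), q₀' ≠ 3 ∧ q₀' ≠ q₀ ∧
          3 ∣ (W.baseChange ℚ_[q₀']).localTamagawaNumber ℤ_[q₀'] ∧ ¬ W.HasSplitMultiplicativeReductionAtPrime q₀') ∨
        ∃ B : Finset ℕ, (∀ q : ℕ, q ∈ B ↔ ∃ _ : Fact q.Prime, q ≠ 3 ∧ W.HasSplitMultiplicativeReductionAtPrime q ∧
            3 ∣ padicValInt q W.minimalDiscriminantInt) ∧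
          Odd B.card ∧ 3 ≤ B.card ∧ 3 ∣ padicValInt 3 W.minimalDiscriminantInt ∧
          (∀ (t₁ t₂ : ℕ) [Fact t₁.Prime] [Fact t₂.Prime], t₁ ≠ 3 → t₂ ≠ 3 → Mult W t₁ → Mult W t₂ →
            t₁ ∉ B → t₂ ∉ B → t₁ = t₂) ∧
          (∀ R' ⊆ B, B.card = 2 * R'.card + 1 → ∃ b ∈ R', b = 2 ∨ 3 ∣ b - 1)) := by
  obtain ⟨B, hB⟩ := exists_finset_splitCarriers W
  -- members of `B` are carriers
  have hBc : ∀ q ∈ B, ∃ _ : Fact q.Prime, q ≠ 3 ∧ W.HasSplitMultiplicativeReductionAtPrime q ∧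
      3 ∣ (W.baseChange ℚ_[q]).localTamagawaNumber ℤ_[q] := by
    intro q hq
    obtain ⟨hF, hq3, hs, hv⟩ := (hB q).mp hq
    exact ⟨hF, hq3, hs, @three_dvd_localTamagawaNumber_of_split_of_three_dvd W _ _ q hF hs hv⟩
  by_cases hΓ : ∀ (q : ℕ) [Fact q.Prime], q ≠ 3 → 3 ∣ (W.baseChange ℚ_[q]).localTamagawaNumber ℤ_[q] →
      W.HasSplitMultiplicativeReductionAtPrime q
  · -- no non-split carrier: parity of `#B` (served either way, g12)
    exfalso
    have hall : ∀ (q : ℕ) [Fact q.Prime], 3 ∣ (W.baseChange ℚ_[q]).localTamagawaNumber ℤ_[q] →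
        W.HasSplitMultiplicativeReductionAtPrime q := by
      intro q _ h3
      by_cases hq3 : q = 3
      · subst hq3
        exact (split_and_three_dvd_of_mult_of_three_dvd_localTamagawaNumber W 3 hX.2.2.1 h3).1
      · exact hΓ q hq3 h3
    rcases Nat.even_or_odd B.card with heven | hodd
    · exact hserv (inertServable_of_ram_of_allSplit_of_even W hX hram hall B hB heven)
    · have hne : B.Nonempty := Finset.card_pos.mp hodd.pos
      obtain ⟨b₀, hb₀⟩ := hne
      obtain ⟨hb₀F, hb₀3, -, hc₀⟩ := hBc b₀ hb₀
      haveI := hb₀F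
      have heven : Even (B.erase b₀).card := by
        rw [Finset.card_erase_of_mem hb₀]
        obtain ⟨r, hr⟩ := hodd
        exact ⟨r, by omega⟩
      exact hsav (inertSavingServable_of_ram_of_allSplitBut_of_even W hX hram b₀ hb₀3 hc₀
        (fun q _ hq3 _ h3 ↦ hΓ q hq3 h3) B hB heven)
  · -- a non-split carrier `g`
    push Not at hΓ
    obtain ⟨g, hgF, hg3, hcg, hgs⟩ := hΓ
    haveI := hgF
    by_cases h2 : ∃ (q₀' : ℕ) (_ : Fact q₀'.Prime), q₀' ≠ 3 ∧ q₀' ≠ g ∧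
        3 ∣ (W.baseChange ℚ_[q₀']).localTamagawaNumber ℤ_[q₀'] ∧ ¬ W.HasSplitMultiplicativeReductionAtPrime q₀'
    · exact ⟨g, hgF, hg3, hcg, hgs, Or.inl h2⟩
    · -- `g` is the ONLY non-split carrier `≠ 3`
      have huniq : ∀ (q : ℕ) [Fact q.Prime], q ≠ 3 → q ≠ g →
          3 ∣ (W.baseChange ℚ_[q]).localTamagawaNumber ℤ_[q] → W.HasSplitMultiplicativeReductionAtPrime q := by
        intro q _ hq3 hqg h3
        by_contra hs
        exact h2 ⟨q, ‹_›, hq3, hqg, h3, hs⟩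
      have hgB : g ∉ B := fun h ↦ by obtain ⟨_, -, hs, -⟩ := (hB g).mp h; exact hgs hs
      have hBg : B.erase g = B := Finset.erase_eq_of_notMem hgB
      rcases Nat.even_or_odd B.card with heven | hodd
      · exact absurd (inertSavingServable_of_ram_of_allSplitBut_of_even W hX hram g hg3 hcg
          (fun q _ hq3 hqg h3 ↦ huniq q hq3 hqg h3) B hB (by rwa [hBg])) hsav
      · by_cases h1 : B.card = 1
        · obtain ⟨b, hb⟩ := Finset.card_eq_one.mp h1
          exact absurd (inertSavingServable_of_ram_of_allSplitBut_of_singleton W hX hram g hg3 hcg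
            (fun q _ hq3 hqg h3 ↦ huniq q hq3 hqg h3) B hB b (by rw [hBg, hb])) hsav
        · -- `#B` odd `≥ 3`: the three new constructors, else the residual
          have h3le : 3 ≤ B.card := by obtain ⟨r, hr⟩ := hodd; omega
          have hoddB' : Odd (B.erase g).card := by rwa [hBg]
          by_cases h3v : 3 ∣ padicValInt 3 W.minimalDiscriminantInt
          · by_cases hsp : ∃ (t₁ t₂ : ℕ) (_ : Fact t₁.Prime) (_ : Fact t₂.Prime), t₁ ≠ 3 ∧ t₂ ≠ 3 ∧
                Mult W t₁ ∧ Mult W t₂ ∧ t₁ ∉ B ∧ t₂ ∉ B ∧ t₁ ≠ t₂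
            · -- two spares: one of them differs from the (ram) witness
              exfalso
              obtain ⟨t₁, t₂, ht₁F, ht₂F, ht₁3, ht₂3, hm₁, hm₂, ht₁B, ht₂B, h12⟩ := hsp
              obtain ⟨ℓ₀, hℓ₀F, hℓ₀3, hmult₀, hram₀⟩ := hram
              haveI := ht₁F
              haveI := ht₂F
              haveI := hℓ₀F
              by_cases ht₁ℓ₀ : t₁ = ℓ₀
              · have ht₂ℓ₀ : t₂ ≠ ℓ₀ := fun h ↦ h12 (ht₁ℓ₀.trans h.symm)
                exact hsav (inertSavingServable_of_allSplitBut_of_odd_of_spare W hX g hg3 hcg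
                  (fun q _ hq3 hqg h3 ↦ huniq q hq3 hqg h3) B hB hoddB' hℓ₀3 hmult₀ hram₀ ht₂3 hm₂ ht₂B ht₂ℓ₀)
              · exact hsav (inertSavingServable_of_allSplitBut_of_odd_of_spare W hX g hg3 hcg
                  (fun q _ hq3 hqg h3 ↦ huniq q hq3 hqg h3) B hB hoddB' hℓ₀3 hmult₀ hram₀ ht₁3 hm₁ ht₁B ht₁ℓ₀)
            · by_cases hPR : ∃ R' ⊆ B, B.card = 2 * R'.card + 1 ∧ ∀ b ∈ R', b ≠ 2 ∧ ¬ 3 ∣ b - 1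
              · exfalso
                obtain ⟨R', hR'B, hcard, hR'⟩ := hPR
                exact hsav (inertSavingServable_of_allSplitBut_of_odd_of_pairingHalf W hX hram g hg3 hcg
                  (fun q _ hq3 hqg h3 ↦ huniq q hq3 hqg h3) B hB R' (by rwa [hBg]) (by rwa [hBg]) hR')
              · -- the residual
                refine ⟨g, hgF, hg3, hcg, hgs, Or.inr ⟨B, hB, hodd, h3le, h3v, ?_, ?_⟩⟩
                · intro t₁ t₂ _ _ ht₁3 ht₂3 hm₁ hm₂ ht₁B ht₂B
                  by_contra h12
                  exact hsp ⟨t₁, t₂, ‹_›, ‹_›, ht₁3, ht₂3, hm₁, hm₂, ht₁B, ht₂B, h12⟩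
                · intro R' hR'B hcard
                  by_contra hno
                  push Not at hno
                  exact hPR ⟨R', hR'B, hcard, fun b hb ↦ ⟨(hno b hb).1, (hno b hb).2⟩⟩
          · exact absurd (inertSavingServable_of_allSplitBut_of_odd_of_three W hX hram g hg3 hcg
              (fun q _ hq3 hqg h3 ↦ huniq q hq3 hqg h3) B hB hoddB' h3v) hsav

end Summit.BirchSwinnertonDyer.Rank1Residual.X11b.Three.Koly

end
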